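import Summits.BirchSwinnertonDyer.BirchSwinnertonDyer.Theorems.RamifiedHeegnerPairTwistUnitInert
import HarnessLib

/-!
# U₁ at the two-SPLIT-carrier Gss2 classes (the Shimura rows), TU|inert — part E: `160254d1`, `171360ca1`

Continuation of `…Theorems.RamifiedHeegnerPairTwistUnitInert` (seat `bsd-trib-w-rhp` g14; the generic lemmas, the two doors
`leafRankOneUpper_three_of_twoCarriers_of_sqrtField` / `leafRankOneUpper_three_of_twoInert_twoOutside_of_sqrtField` and the full framing are there): per rank-one curve
`subGss_three_<label>` (Addv ∧ SubGss at `3` in the kernel), `Δ_eq_/c₄_eq_/krausList_<label>`, Kraus minimality of `V = E^{(-3)}_min` and of the twist model `Wd`, and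
`u1_at_<label> : … → MissingUpperBoundAt W 3` by rhp-p2 g10's two-carrier instrument p657297 `LeafShimuraInert.leafRankOneUpper_three_of_twoCarriers_of_twistUnit`
(resp. p654714 `…_of_shimuraInertDatum_of_twistUnit` on the two-outside rows) with the six printed facts `hGZK hmod hnf hJL hCO hHK` as hypotheses, the split / no-split / Tate
certificates, `hothers`, `hshape` and the field congruences IN THE KERNEL, and `hN hr Dt hc` + the twist `L`-value + `#Ш(Wd)_an` DISPLAYED (+ `bsd3_at_<label>`, lower half
free).  **HONEST FRAMING: theorems only; per-curve certificates under DISPLAYED inputs (conductor, analytic rank, `3 ∤ c(Dt)`, the twist `L`-value, `#Ш(Wd)_an`) and the six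
printed facts of the road as hypotheses; nothing is booked, no item is closed; U₁ (26022) / TU|inert / the Shimura-curve Gross–Zagier–Kolyvagin inputs stay research-level and
OPEN class-wide; BSD is NOT proved for any curve by this file.**
[cite: JetchevSkinnerWan2017, §7.4.2 (p. 31), Thm. 4.4.1 (p. 19)] [cite: PastenShimura2024, Prop. 6.13, Lemma 6.16, Lemma 6.18 (pp. 23–24)]
[cite: PapikianRabinoff2016, Cor. 3.5] [cite: SilvermanAEC2009, VII.5 Prop. 5.1] [cite: SilvermanATAEC1994, IV.9.4] [cite: Tate1975, §7] [cite: Kraus1989, Prop. 1]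
[cite: Marcus2018, Ch. 3 Thm. 25] [cite: Miller2011LMS, Def. 1.1] [cite: Cremona2006, Table 1]
-/

set_option linter.dupNamespace false
set_option autoImplicit false

noncomputable section

open scoped Classical NumberField

open WeierstrassCurve NumberField IsDedekindDomain IsDedekindDomain.HeightOneSpectrum Rat.HeightOneSpectrum Field Literature Literature.NumberTheory.DiophantineGeometry
  Literature.NumberTheory.EllipticCurves Literature.NumberTheory.EllipticCurves.ModularForms Literature.NumberTheory.EllipticCurves.Rank1Residual
  Literature.NumberTheory.EllipticCurves.Rank1Residual.Typed Literature.NumberTheory.Automorphic Literature.NumberTheory.EllipticCurves.Rank1Residual.X11RankOneCertificates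
  Literature.NumberTheory.EllipticCurves.KrizLi2019 Literature.NumberTheory.GaloisRepresentations Literature.NumberTheory.QuadraticFields Literature.NumberTheory.QuadraticFields.Quadratic
  Summit.BirchSwinnertonDyer.BirchSwinnertonDyer.Rank1Residual Summit.BirchSwinnertonDyer.BirchSwinnertonDyer.Rank1Residual.IntModel
  Summit.BirchSwinnertonDyer.BirchSwinnertonDyer.Rank2Observatory.Tam Summit.BirchSwinnertonDyer.Rank1Residual Summit.BirchSwinnertonDyer.Rank1Residual.Additive
  Summit.BirchSwinnertonDyer.Rank1Residual.X11b Summit.BirchSwinnertonDyer.Rank1Residual.X11b.Three Summit.BirchSwinnertonDyer.Rank1Residual.X9 Summit.BirchSwinnertonDyer.Rank1Residual.GaloisImage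
  Summit.BirchSwinnertonDyer.Rank1Residual.Supersingular Summit.BirchSwinnertonDyer.BirchSwinnertonDyer.Theses.RamifiedHeegnerPair Summit.BirchSwinnertonDyer.BirchSwinnertonDyer.Theorems
  Summit.BirchSwinnertonDyer.BirchSwinnertonDyer.Theorems.SchneiderFree Summit.BirchSwinnertonDyer.BirchSwinnertonDyer.Theorems.RamifiedPairUpperBound
  Summit.BirchSwinnertonDyer.BirchSwinnertonDyer.Theorems.RamifiedHeegnerPairStepLIntrinsic Summit.BirchSwinnertonDyer.BirchSwinnertonDyer.Theorems.AdditiveBranchIMCGordTwoRankOne.HeegnerKolyvagin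
  Summit.BirchSwinnertonDyer.BirchSwinnertonDyer.Theorems.RamifiedHeegnerPairTwistUnitIntrinsic Summit.BirchSwinnertonDyer.BirchSwinnertonDyer.Theorems.RamifiedHeegnerPairTwistUnitAdditive

namespace Summit.BirchSwinnertonDyer.BirchSwinnertonDyer.Theorems.RamifiedHeegnerPairTwistUnitInert

/-! ## §7 `160254d1` = `[1, -1, 1, 412, 80263]`, `N = 160254 = 2·3^2·29·307` (`2`: I9, `c = 9`, split, `3`: I₀*, `c = 2`, `29`: I3, `c = 3`, split, `307`: I1, `c = 1`, split); carriers `S = {2, 29}` (split, `3 ∣ ord Δ`), (DEG) by Papikian–Rabinoff at `q₂ = 29` (odd, `≡ 2 (mod 3)`);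
`r_an = 1`, `#E(ℚ)_tors = 1`, `∏ c_ℓ = 54`, `#Ш(E)_an = 1` (Cremona/LMFDB, displayed where used); class `160254d` of size 1.
`V = E^{(-3)}_min = [1, -1, 0, 46, -2988]` (`#Ṽ(𝔽₃) = 4`).  JSW field `K = ℚ(√-395)` (`395 = 5·79`; `2`, `29` inert, every other `ℓ ∣ N` split): the least such `D` with a twist unit
(kit j317417: `L(E^{(-395)},1)/Ω = 4 ≠ 0`, root no. `+1`, `Wd = E^{(-395)}_min = [1, -1, 0, 64331058, -4952983802284]`, `N(Wd) = 25003630350`, `∏c = 4`, `T = 1`, `#Ш(Wd)_an = (L/Ω)T²/∏c = 1` exactly). -/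

/-- `V = [1, -1, 0, 46, -2988]` (the minimal model of `160254d1^{(-3)}`, conductor `17806`): `Δ ≠ 0` in the kernel. [cite: Cremona2006, Table 1 (Cremona label 160254d1)] -/
theorem isElliptic_sV160254d1 : (⟨1, -1, 0, 46, -2988⟩ : WeierstrassCurve ℚ).IsElliptic :=
  isElliptic_of_discOf_ne_zero 1 (-1) 0 46 (-2988) (by decide +kernel)

/-- `V` is globally minimal: `|Δ| = 2^9·29^3·307` kernel-checked, Kraus' criterion prime by prime. [cite: Kraus1989, Prop. 1 and Prop. 2]
[cite: SilvermanAEC2009, VII.1 Remark 1.1] [cite: Cremona2006, Table 1 (Cremona label 160254d1)] -/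
theorem isGloballyMinimal_sV160254d1 : (⟨1, -1, 0, 46, -2988⟩ : WeierstrassCurve ℚ).IsGloballyMinimal :=
  isGloballyMinimal_of_krausCriterion₃_factored 1 (-1) 0 46 (-2988)
    [(2, 9), (29, 3), (307, 1)] (by decide +kernel)
    (by intro qe hqe; simp only [List.mem_cons, List.not_mem_nil, or_false] at hqe
        rcases hqe with rfl | rfl | rfl <;> norm_num)
    (by set_option synthInstance.maxSize 2000 in decide +kernel)

/-- `Wd = [1, -1, 0, 64331058, -4952983802284]` (the minimal model of the twist `160254d1^{(-395)}`, conductor `25003630350`): `Δ ≠ 0` in the kernel. [cite: Cremona2006, Table 1 (Cremona label 160254d1)] -/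
theorem isElliptic_sWd160254d1 : (⟨1, -1, 0, 64331058, -4952983802284⟩ : WeierstrassCurve ℚ).IsElliptic :=
  isElliptic_of_discOf_ne_zero 1 (-1) 0 64331058 (-4952983802284) (by decide +kernel)

/-- `Wd` is globally minimal: `|Δ| = 2^9·3^6·5^6·29^3·79^6·307` kernel-checked, Kraus' criterion prime by prime. [cite: Kraus1989, Prop. 1 and Prop. 2]
[cite: SilvermanAEC2009, VII.1 Remark 1.1] [cite: Cremona2006, Table 1 (Cremona label 160254d1)] -/
theorem isGloballyMinimal_sWd160254d1 : (⟨1, -1, 0, 64331058, -4952983802284⟩ : WeierstrassCurve ℚ).IsGloballyMinimal :=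
  isGloballyMinimal_of_krausCriterion₃_factored 1 (-1) 0 64331058 (-4952983802284)
    [(2, 9), (3, 6), (5, 6), (29, 3), (79, 6), (307, 1)] (by decide +kernel)
    (by intro qe hqe; simp only [List.mem_cons, List.not_mem_nil, or_false] at hqe
        rcases hqe with rfl | rfl | rfl | rfl | rfl | rfl <;> norm_num)
    (by set_option synthInstance.maxSize 2000 in decide +kernel)

/-- **`160254d1` is ADDITIVE at `3` and on the cell (G) ∧ ss, IN THE KERNEL**: `3 ∣ Δ`, `3 ∣ c₄`; `C • V^{(-3)} = E` (`[u, r, s, t] = [1, -1, 1/2, 1/2]`) with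
`V` globally minimal, `3 ∤ Δ(V)`, `#Ṽ(𝔽₃) = 4` (`a₃(V) = 0`, supersingular), whence `TypeG`, `SubGord`, `SubGss` at `3` (g13's block, unchanged).
[cite: SilvermanAEC2009, VII.5 Prop. 5.1 (a), (c)] [cite: Delbourgo1998, §1.5 (G)] [cite: Cremona2006, Table 1 (Cremona label 160254d1)] -/
theorem subGss_three_160254d1 {W : WeierstrassCurve ℚ} [W.IsElliptic] [W.IsGloballyMinimal] (hWeq : W = (⟨1, -1, 1, 412, 80263⟩ : WeierstrassCurve ℚ)) :
    Addv W 3 ∧ SubGss W 3 := by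
  subst hWeq
  haveI := isElliptic_sV160254d1
  haveI := isGloballyMinimal_sV160254d1
  have hIW : integralModelInt (⟨1, -1, 1, 412, 80263⟩ : WeierstrassCurve ℚ) = (⟨1, -1, 1, 412, 80263⟩ : WeierstrassCurve ℤ) :=
    integralModelInt_eq_of_map_eq _ (map_mk_int 1 (-1) 1 412 80263)
  have hadd : Addv (⟨1, -1, 1, 412, 80263⟩ : WeierstrassCurve ℚ) 3 := Additive.addv_of_intModel hIW 3 (by decide +kernel) (by decide +kernel)
  have hIV : integralModelInt (⟨1, -1, 0, 46, -2988⟩ : WeierstrassCurve ℚ) = (⟨1, -1, 0, 46, -2988⟩ : WeierstrassCurve ℤ) :=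
    integralModelInt_eq_of_map_eq _ (map_mk_int 1 (-1) 0 46 (-2988))
  have hcV : Nat.card ((((⟨1, -1, 0, 46, -2988⟩ : WeierstrassCurve ℤ)).map (Int.castRingHom (ZMod 3))).toAffine.Point) = 4 := by
    have h := natCard_point_eq_countPoints 1 (-1) 0 46 (-2988) 3 (by norm_num) (by decide +kernel)
    have h' : countPoints [1, -1, 0, 46, -2988] 3 = 4 := countPoints_eq_of_fast (by decide +kernel)
    exact_mod_cast h.trans h'
  have hgood : GoodSS (⟨1, -1, 0, 46, -2988⟩ : WeierstrassCurve ℚ) 3 := Supersingular.goodSS_of_intModel 3 hIV (by decide +kernel) hcV (by decide)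
  have hVW : (⟨1, (-1 : ℚ), ((1:ℚ)/2), ((1:ℚ)/2)⟩ : VariableChange ℚ) • (⟨1, -1, 0, 46, -2988⟩ : WeierstrassCurve ℚ).quadraticTwist (-3) =
      (⟨1, -1, 1, 412, 80263⟩ : WeierstrassCurve ℚ) := by
    ext <;> simp [WeierstrassCurve.variableChange_a₁, WeierstrassCurve.variableChange_a₂,
      WeierstrassCurve.variableChange_a₃, WeierstrassCurve.variableChange_a₄, WeierstrassCurve.variableChange_a₆,
      WeierstrassCurve.quadraticTwist, WeierstrassCurve.b₂, WeierstrassCurve.b₄, WeierstrassCurve.b₆] <;> norm_num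
  obtain ⟨C, hC⟩ := exists_variableChange_quadraticTwist_symm (⟨1, -1, 1, 412, 80263⟩ : WeierstrassCurve ℚ)
    (⟨1, -1, 0, 46, -2988⟩ : WeierstrassCurve ℚ) (d := (-3 : ℚ)) (by norm_num) ⟨_, hVW⟩
  have hC' : C • (⟨1, -1, 1, 412, 80263⟩ : WeierstrassCurve ℚ).quadraticTwist ((-1 : ℚ) ^ ((3 : ℕ) / 2) * (3 : ℕ)) =
      (⟨1, -1, 0, 46, -2988⟩ : WeierstrassCurve ℚ) := by
    rw [O5.pstar_three]; exact hC
  have hG : TypeG (⟨1, -1, 1, 412, 80263⟩ : WeierstrassCurve ℚ) 3 := (typeG_three_iff_good_twist _ hadd _ C hC').mpr hgood.1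
  exact ⟨hadd, (O5.subGss_three_iff_subGord_and_goodSS_twist _ hadd _ C hC).mpr
    ⟨subGord_three_of_typeG_of_addv _ hG hadd, hgood⟩⟩

/-- `Δ(E₀) = -2794665659904 = -2^9·3^6·29^3·307` on the integer equation of `160254d1`. [cite: Cremona2006, Table 1 (Cremona label 160254d1)] -/
theorem Δ_eq_160254d1 : (⟨1, -1, 1, 412, 80263⟩ : WeierstrassCurve ℤ).Δ = -2794665659904 := by
  norm_num [WeierstrassCurve.Δ, WeierstrassCurve.b₂, WeierstrassCurve.b₄, WeierstrassCurve.b₆, WeierstrassCurve.b₈]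

/-- `c₄(E₀) = -19791` on the integer equation of `160254d1`. [cite: Cremona2006, Table 1 (Cremona label 160254d1)] -/
theorem c₄_eq_160254d1 : (⟨1, -1, 1, 412, 80263⟩ : WeierstrassCurve ℤ).c₄ = -19791 := by
  norm_num [WeierstrassCurve.c₄, WeierstrassCurve.b₂, WeierstrassCurve.b₄]

/-- The Kraus list of `160254d1` consists of primes and multiplies to `|Δ(E₀)|`, IN THE KERNEL: a prime dividing `Δ_min` is one of `[2, 3, 29, 307]`. [cite: Cremona2006, Table 1 (Cremona label 160254d1)] -/
theorem krausList_160254d1 : (∀ qe ∈ ([(2, 9), (3, 6), (29, 3), (307, 1)] : List (ℕ × ℕ)), qe.1.Prime) ∧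
    (([(2, 9), (3, 6), (29, 3), (307, 1)] : List (ℕ × ℕ)).map fun qe => qe.1 ^ qe.2).prod = (-2794665659904 : ℤ).natAbs :=
  ⟨by decide +kernel, by decide +kernel⟩

/-- **U₁ AT `160254d1` BY THE INERT-CARRIER (Shimura-curve) ROAD, TU|inert** — `MissingUpperBoundAt W 3` at `W = E` from rhp-p2 g10's instrument
p657297 (two carriers, Papikian–Rabinoff (DEG)) through the §0 door `leafRankOneUpper_three_of_twoCarriers_of_sqrtField` of part one.  PRINTED: `hGZK hmod hnf hJL hCO hHK`.  KERNEL: `Addv ∧ SubGss` at `3`;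
`2`, `29` split (nodal roots `0`, `2`); every prime of `Δ_min` enumerated (`krausList_160254d1`) for `hothers` and `hshape` (`c = 1` off `Δ_min`, Kodaira–Néron at the
multiplicative primes, Tate certificates at the additive primes `[3]`); the congruences making `2`, `29` inert and the other `ℓ ∣ N` split in `ℚ(√-395)`; the twist
identity `Cd • E^{(-395)} = Wd`, `Cd = [1, -99, 1/2, 0]`, with `Wd` Kraus-minimal.  DISPLAYED: `hN`, `hr`, `Dt`/`hc` (`3 ∤ c(Dt)`), `hLt` (`L(E^{(-395)},1) ≠ 0`), `hqd`/`hvd`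
(`#Ш(Wd)_an = 1`).  NO ¬CM / S2 / Σ / L₀.  Per curve; U₁ (26022) stays OPEN class-wide; `BSDp W 3` follows by `bsdp_three_of_upper_of_shaAn_unit`; BSD is NOT proved by this.
[cite: JetchevSkinnerWan2017, §7.4.2 (p. 31)] [cite: PastenShimura2024, Prop. 6.13, Lemma 6.18] [cite: SilvermanAEC2009, VII.5 Prop. 5.1] [cite: Cremona2006, Table 1 (Cremona label 160254d1)] -/
theorem u1_at_160254d1
    (hGZK : rank_eq_analyticRank_of_analyticRank_le_one) (hmod : hasEntireLFunction_rat)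
    (hnf : exists_isNewformOf) (hJL : nonempty_shimuraParametrizationData)
    (hCO : PastenShimura2024_componentOrders)
    (hHK : shimuraCurve_heegnerPoint_grossZagier_kolyvagin)
    {W : WeierstrassCurve ℚ} [W.IsElliptic] [W.IsGloballyMinimal] (hWeq : W = (⟨1, -1, 1, 412, 80263⟩ : WeierstrassCurve ℚ))
    (hN : W.conductorNorm ℤ = 160254) [NeZero (W.conductorNorm ℤ)] (hr : W.analyticRank = 1)
    (Dt : ModularParametrizationData W (W.conductorNorm ℤ)) (hc : ¬ (3 : ℤ) ∣ Dt.c)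
    (hLt : (W.quadraticTwist (((-395 : ℤ) : ℚ))).entireLFunction 1 ≠ 0)
    {qd : ℚ} (hqd : haveI := isElliptic_sWd160254d1; shaAn (⟨1, -1, 0, 64331058, -4952983802284⟩ : WeierstrassCurve ℚ) = (qd : ℂ))
    (hvd : padicValRat 3 qd ≤ 0) :
    MissingUpperBoundAt W 3 := by
  subst hWeq
  haveI := isElliptic_sWd160254d1; haveI := isGloballyMinimal_sWd160254d1
  have hI : integralModelInt (⟨1, -1, 1, 412, 80263⟩ : WeierstrassCurve ℚ) = (⟨1, -1, 1, 412, 80263⟩ : WeierstrassCurve ℤ) :=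
    integralModelInt_eq_of_map_eq _ (map_mk_int 1 (-1) 1 412 80263)
  have hGS := subGss_three_160254d1 (W := (⟨1, -1, 1, 412, 80263⟩ : WeierstrassCurve ℚ)) rfl
  have hs₁ : haveI : Fact (Nat.Prime 2) := ⟨by norm_num⟩; (⟨1, -1, 1, 412, 80263⟩ : WeierstrassCurve ℚ).HasSplitMultiplicativeReductionAtPrime 2 := by
    refine IntModel.hasSplitMultiplicativeReductionAtPrime_of_intModel_of_root hI 2 (by rw [Δ_eq_160254d1]; norm_num) (by rw [c₄_eq_160254d1]; norm_num) ⟨0, ?_⟩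
    simp only [WeierstrassCurve.c₄, WeierstrassCurve.b₂, WeierstrassCurve.b₄, WeierstrassCurve.b₆]; push_cast; decide
  have hs₂ : haveI : Fact (Nat.Prime 29) := ⟨by norm_num⟩; (⟨1, -1, 1, 412, 80263⟩ : WeierstrassCurve ℚ).HasSplitMultiplicativeReductionAtPrime 29 := by
    refine IntModel.hasSplitMultiplicativeReductionAtPrime_of_intModel_of_root hI 29 (by rw [Δ_eq_160254d1]; norm_num) (by rw [c₄_eq_160254d1]; norm_num) ⟨2, ?_⟩
    simp only [WeierstrassCurve.c₄, WeierstrassCurve.b₂, WeierstrassCurve.b₄, WeierstrassCurve.b₆]; push_cast; decide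
  haveI : Fact ((-395 : ℤ) < 0) := ⟨by norm_num⟩; haveI : Fact (Nat.Prime 2) := ⟨by norm_num⟩; haveI : Fact (Nat.Prime 29) := ⟨by norm_num⟩
  have hothers : ∀ (ℓ : ℕ) [Fact ℓ.Prime], ℓ ≠ 2 → ℓ ≠ 29 → (⟨1, -1, 1, 412, 80263⟩ : WeierstrassCurve ℚ).HasSplitMultiplicativeReductionAtPrime ℓ →
      ¬ 3 ∣ padicValInt ℓ (⟨1, -1, 1, 412, 80263⟩ : WeierstrassCurve ℚ).minimalDiscriminantInt := by
    intro ℓ hℓF hne₁ hne₂ hs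
    have hd := dvd_minimalDiscriminantInt_of_mult _ ℓ hs.hasMultiplicativeReductionAtPrime
    rw [IntModel.minimalDiscriminantInt_eq hI, Δ_eq_160254d1] at hd
    have hmem := mem_of_prime_dvd_of_prodPow_eq _ krausList_160254d1 hℓF.out hd
    simp only [List.map_cons, List.map_nil, List.mem_cons, List.not_mem_nil, or_false] at hmem
    rcases hmem with rfl | rfl | rfl | rfl
    · exact absurd rfl hne₁
    · exact absurd hs.hasMultiplicativeReductionAtPrime (X9.PrintCert.not_hasMultiplicativeReductionAtPrime_of_dvd_of_dvd hI 3 (by rw [Δ_eq_160254d1]; norm_num) (by rw [c₄_eq_160254d1]; norm_num))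
    · exact absurd rfl hne₂
    · rw [IntModel.minimalDiscriminantInt_eq hI, Δ_eq_160254d1, IntModel.padicValInt_eq_of_dvd_of_not_dvd 307 (e := 1) (by norm_num) (by norm_num)]
      decide
  have hshape : ∀ (q : ℕ) [Fact q.Prime], 3 ∣ ((⟨1, -1, 1, 412, 80263⟩ : WeierstrassCurve ℚ).baseChange ℚ_[q]).localTamagawaNumber ℤ_[q] →
      (⟨1, -1, 1, 412, 80263⟩ : WeierstrassCurve ℚ).HasSplitMultiplicativeReductionAtPrime q := by
    intro q hqF h3
    by_cases hd : (q : ℤ) ∣ minimalDiscriminantInt (⟨1, -1, 1, 412, 80263⟩ : WeierstrassCurve ℚ)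
    swap
    · exact absurd h3 (not_three_dvd_localTamagawaNumber_of_not_dvd _ q hd)
    rw [IntModel.minimalDiscriminantInt_eq hI, Δ_eq_160254d1] at hd
    have hmem := mem_of_prime_dvd_of_prodPow_eq _ krausList_160254d1 hqF.out hd
    simp only [List.map_cons, List.map_nil, List.mem_cons, List.not_mem_nil, or_false] at hmem
    rcases hmem with rfl | rfl | rfl | rfl
    · exact hs₁
    · have hc3 : ((⟨1, -1, 1, 412, 80263⟩ : WeierstrassCurve ℚ).baseChange ℚ_[3]).localTamagawaNumber ℤ_[3] = 2 := -- additive `3` (I0*): Tate certificate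
        (IntModelTam.localTamagawaNumber_padic_eq_of_intModel_of_tamZ hI 3 (F := ⟨3, 9, 1, 1, 8, 6, 0, 1⟩) rfl (by decide +kernel)).trans (by decide)
      rw [hc3] at h3; exact absurd h3 (by decide)
    · exact hs₂
    · exact (Koly.split_and_three_dvd_of_mult_of_three_dvd_localTamagawaNumber _ 307 (IntModel.hasMultiplicativeReductionAtPrime_of_intModel hI 307 (by rw [Δ_eq_160254d1]; norm_num) (by rw [c₄_eq_160254d1]; norm_num)) h3).1
  have hjac : ∀ ℓ : ℕ, ℓ.Prime → ℓ ∣ (⟨1, -1, 1, 412, 80263⟩ : WeierstrassCurve ℚ).conductorNorm ℤ → ℓ ≠ 2 → ℓ ≠ 29 → ℓ ≠ 2 →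
      jacobiSym (-395) ℓ = 1 := by
    intro ℓ hℓ hℓN hne₁ hne₂ hℓ2
    rw [hN] at hℓN
    have hmem : ℓ ∈ Nat.primeFactors 160254 := Nat.mem_primeFactors.mpr ⟨hℓ, hℓN, by norm_num⟩
    rw [show Nat.primeFactors 160254 = {2, 3, 29, 307} by decide +kernel] at hmem
    simp only [Finset.mem_insert, Finset.mem_singleton] at hmem
    rcases hmem with rfl | rfl | rfl | rfl
    · exact absurd rfl hne₁
    · norm_num [jacobiSym.mod_left]
    · exact absurd rfl hne₂
    · norm_num [jacobiSym.mod_left]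
  have hWd : (⟨1, (-99 : ℚ), ((1:ℚ)/2), (0 : ℚ)⟩ : VariableChange ℚ) • (⟨1, -1, 1, 412, 80263⟩ : WeierstrassCurve ℚ).quadraticTwist (((-395 : ℤ) : ℚ)) =
      (⟨1, -1, 0, 64331058, -4952983802284⟩ : WeierstrassCurve ℚ) := by
    push_cast; ext <;> simp [WeierstrassCurve.variableChange_a₁, WeierstrassCurve.variableChange_a₂,
      WeierstrassCurve.variableChange_a₃, WeierstrassCurve.variableChange_a₄, WeierstrassCurve.variableChange_a₆,
      WeierstrassCurve.quadraticTwist, WeierstrassCurve.b₂, WeierstrassCurve.b₄, WeierstrassCurve.b₆] <;> norm_num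
  exact leafRankOneUpper_three_of_twoCarriers_of_sqrtField hGZK hmod hnf hJL hCO hHK _ hGS.1 hGS.2 hr rfl Dt hc
    (q₁ := 2) (q₂ := 29) (by decide) hs₁ hs₂ hothers (by decide) (by decide) hshape
    (-395) (by norm_num)
    (by rw [show (-395 : ℤ).natAbs = 395 by rfl, Nat.squarefree_iff_nodup_primeFactorsList (by norm_num)]; simp)
    (Or.inl ⟨rfl, by norm_num⟩) (by norm_num) (by norm_num [jacobiSym.mod_left]) (by norm_num) hjac
    (fun _ h ↦ absurd rfl h) hLt _ _ hWd hqd hvd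

/-! ## §8 `171360ca1` = `[0, 0, 0, -4392, -132624]`, `N = 171360 = 2^5·3^2·5·7·17` (`2`: III*, `c = 2`, `3`: I₀*, `c = 2`, `5`: I3, `c = 3`, split, `7`: I3, `c = 3`, split, `17`: I1, `c = 1`, split); carriers `S = {7, 5}` (split, `3 ∣ ord Δ`), (DEG) by Papikian–Rabinoff at `q₂ = 5` (odd, `≡ 2 (mod 3)`);
`r_an = 1`, `#E(ℚ)_tors = 1`, `∏ c_ℓ = 36`, `#Ш(E)_an = 1` (Cremona/LMFDB, displayed where used); class `171360ca` of size 1.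
`V = E^{(-3)}_min = [0, 0, 0, -488, 4912]` (`#Ṽ(𝔽₃) = 4`).  JSW field `K = ℚ(√-263)` (`263` prime; `7`, `5` inert, every other `ℓ ∣ N` split): the least such `D` with a twist unit
(kit j317417: `L(E^{(-263)},1)/Ω = 8 ≠ 0`, root no. `+1`, `Wd = E^{(-263)}_min = [0, 0, 0, -303790248, 2412622466928]`, `N(Wd) = 11852799840`, `∏c = 8`, `T = 1`, `#Ш(Wd)_an = (L/Ω)T²/∏c = 1` exactly). -/

/-- `V = [0, 0, 0, -488, 4912]` (the minimal model of `171360ca1^{(-3)}`, conductor `19040`): `Δ ≠ 0` in the kernel. [cite: Cremona2006, Table 1 (Cremona label 171360ca1)] -/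
theorem isElliptic_sV171360ca1 : (⟨0, 0, 0, -488, 4912⟩ : WeierstrassCurve ℚ).IsElliptic :=
  isElliptic_of_discOf_ne_zero 0 0 0 (-488) 4912 (by decide +kernel)

/-- `V` is globally minimal: `|Δ| = 2^12·5^3·7^3·17` kernel-checked, Kraus' criterion prime by prime. [cite: Kraus1989, Prop. 1 and Prop. 2]
[cite: SilvermanAEC2009, VII.1 Remark 1.1] [cite: Cremona2006, Table 1 (Cremona label 171360ca1)] -/
theorem isGloballyMinimal_sV171360ca1 : (⟨0, 0, 0, -488, 4912⟩ : WeierstrassCurve ℚ).IsGloballyMinimal :=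
  isGloballyMinimal_of_krausCriterion₃_factored 0 0 0 (-488) 4912
    [(2, 12), (5, 3), (7, 3), (17, 1)] (by decide +kernel)
    (by intro qe hqe; simp only [List.mem_cons, List.not_mem_nil, or_false] at hqe
        rcases hqe with rfl | rfl | rfl | rfl <;> norm_num)
    (by set_option synthInstance.maxSize 2000 in decide +kernel)

/-- `Wd = [0, 0, 0, -303790248, 2412622466928]` (the minimal model of the twist `171360ca1^{(-263)}`, conductor `11852799840`): `Δ ≠ 0` in the kernel. [cite: Cremona2006, Table 1 (Cremona label 171360ca1)] -/
theorem isElliptic_sWd171360ca1 : (⟨0, 0, 0, -303790248, 2412622466928⟩ : WeierstrassCurve ℚ).IsElliptic :=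
  isElliptic_of_discOf_ne_zero 0 0 0 (-303790248) 2412622466928 (by decide +kernel)

/-- `Wd` is globally minimal: `|Δ| = 2^12·3^6·5^3·7^3·17·263^6` kernel-checked, Kraus' criterion prime by prime. [cite: Kraus1989, Prop. 1 and Prop. 2]
[cite: SilvermanAEC2009, VII.1 Remark 1.1] [cite: Cremona2006, Table 1 (Cremona label 171360ca1)] -/
theorem isGloballyMinimal_sWd171360ca1 : (⟨0, 0, 0, -303790248, 2412622466928⟩ : WeierstrassCurve ℚ).IsGloballyMinimal :=
  isGloballyMinimal_of_krausCriterion₃_factored 0 0 0 (-303790248) 2412622466928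
    [(2, 12), (3, 6), (5, 3), (7, 3), (17, 1), (263, 6)] (by decide +kernel)
    (by intro qe hqe; simp only [List.mem_cons, List.not_mem_nil, or_false] at hqe
        rcases hqe with rfl | rfl | rfl | rfl | rfl | rfl <;> norm_num)
    (by set_option synthInstance.maxSize 2000 in decide +kernel)

/-- **`171360ca1` is ADDITIVE at `3` and on the cell (G) ∧ ss, IN THE KERNEL**: `3 ∣ Δ`, `3 ∣ c₄`; `C • V^{(-3)} = E` (`[u, r, s, t] = [1, 0, 0, 0]`) with
`V` globally minimal, `3 ∤ Δ(V)`, `#Ṽ(𝔽₃) = 4` (`a₃(V) = 0`, supersingular), whence `TypeG`, `SubGord`, `SubGss` at `3` (g13's block, unchanged).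
[cite: SilvermanAEC2009, VII.5 Prop. 5.1 (a), (c)] [cite: Delbourgo1998, §1.5 (G)] [cite: Cremona2006, Table 1 (Cremona label 171360ca1)] -/
theorem subGss_three_171360ca1 {W : WeierstrassCurve ℚ} [W.IsElliptic] [W.IsGloballyMinimal] (hWeq : W = (⟨0, 0, 0, -4392, -132624⟩ : WeierstrassCurve ℚ)) :
    Addv W 3 ∧ SubGss W 3 := by
  subst hWeq
  haveI := isElliptic_sV171360ca1
  haveI := isGloballyMinimal_sV171360ca1
  have hIW : integralModelInt (⟨0, 0, 0, -4392, -132624⟩ : WeierstrassCurve ℚ) = (⟨0, 0, 0, -4392, -132624⟩ : WeierstrassCurve ℤ) :=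
    integralModelInt_eq_of_map_eq _ (map_mk_int 0 0 0 (-4392) (-132624))
  have hadd : Addv (⟨0, 0, 0, -4392, -132624⟩ : WeierstrassCurve ℚ) 3 := Additive.addv_of_intModel hIW 3 (by decide +kernel) (by decide +kernel)
  have hIV : integralModelInt (⟨0, 0, 0, -488, 4912⟩ : WeierstrassCurve ℚ) = (⟨0, 0, 0, -488, 4912⟩ : WeierstrassCurve ℤ) :=
    integralModelInt_eq_of_map_eq _ (map_mk_int 0 0 0 (-488) 4912)
  have hcV : Nat.card ((((⟨0, 0, 0, -488, 4912⟩ : WeierstrassCurve ℤ)).map (Int.castRingHom (ZMod 3))).toAffine.Point) = 4 := by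
    have h := natCard_point_eq_countPoints 0 0 0 (-488) 4912 3 (by norm_num) (by decide +kernel)
    have h' : countPoints [0, 0, 0, -488, 4912] 3 = 4 := countPoints_eq_of_fast (by decide +kernel)
    exact_mod_cast h.trans h'
  have hgood : GoodSS (⟨0, 0, 0, -488, 4912⟩ : WeierstrassCurve ℚ) 3 := Supersingular.goodSS_of_intModel 3 hIV (by decide +kernel) hcV (by decide)
  have hVW : (⟨1, (0 : ℚ), (0 : ℚ), (0 : ℚ)⟩ : VariableChange ℚ) • (⟨0, 0, 0, -488, 4912⟩ : WeierstrassCurve ℚ).quadraticTwist (-3) =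
      (⟨0, 0, 0, -4392, -132624⟩ : WeierstrassCurve ℚ) := by
    ext <;> simp [WeierstrassCurve.variableChange_a₁, WeierstrassCurve.variableChange_a₂,
      WeierstrassCurve.variableChange_a₃, WeierstrassCurve.variableChange_a₄, WeierstrassCurve.variableChange_a₆,
      WeierstrassCurve.quadraticTwist, WeierstrassCurve.b₂, WeierstrassCurve.b₄, WeierstrassCurve.b₆] <;> norm_num
  obtain ⟨C, hC⟩ := exists_variableChange_quadraticTwist_symm (⟨0, 0, 0, -4392, -132624⟩ : WeierstrassCurve ℚ)
    (⟨0, 0, 0, -488, 4912⟩ : WeierstrassCurve ℚ) (d := (-3 : ℚ)) (by norm_num) ⟨_, hVW⟩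
  have hC' : C • (⟨0, 0, 0, -4392, -132624⟩ : WeierstrassCurve ℚ).quadraticTwist ((-1 : ℚ) ^ ((3 : ℕ) / 2) * (3 : ℕ)) =
      (⟨0, 0, 0, -488, 4912⟩ : WeierstrassCurve ℚ) := by
    rw [O5.pstar_three]; exact hC
  have hG : TypeG (⟨0, 0, 0, -4392, -132624⟩ : WeierstrassCurve ℚ) 3 := (typeG_three_iff_good_twist _ hadd _ C hC').mpr hgood.1
  exact ⟨hadd, (O5.subGss_three_iff_subGord_and_goodSS_twist _ hadd _ C hC).mpr
    ⟨subGord_three_of_typeG_of_addv _ hG hadd, hgood⟩⟩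

/-- `Δ(E₀) = -2176409088000 = -2^12·3^6·5^3·7^3·17` on the integer equation of `171360ca1`. [cite: Cremona2006, Table 1 (Cremona label 171360ca1)] -/
theorem Δ_eq_171360ca1 : (⟨0, 0, 0, -4392, -132624⟩ : WeierstrassCurve ℤ).Δ = -2176409088000 := by
  norm_num [WeierstrassCurve.Δ, WeierstrassCurve.b₂, WeierstrassCurve.b₄, WeierstrassCurve.b₆, WeierstrassCurve.b₈]

/-- `c₄(E₀) = 210816` on the integer equation of `171360ca1`. [cite: Cremona2006, Table 1 (Cremona label 171360ca1)] -/
theorem c₄_eq_171360ca1 : (⟨0, 0, 0, -4392, -132624⟩ : WeierstrassCurve ℤ).c₄ = 210816 := by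
  norm_num [WeierstrassCurve.c₄, WeierstrassCurve.b₂, WeierstrassCurve.b₄]

/-- The Kraus list of `171360ca1` consists of primes and multiplies to `|Δ(E₀)|`, IN THE KERNEL: a prime dividing `Δ_min` is one of `[2, 3, 5, 7, 17]`. [cite: Cremona2006, Table 1 (Cremona label 171360ca1)] -/
theorem krausList_171360ca1 : (∀ qe ∈ ([(2, 12), (3, 6), (5, 3), (7, 3), (17, 1)] : List (ℕ × ℕ)), qe.1.Prime) ∧
    (([(2, 12), (3, 6), (5, 3), (7, 3), (17, 1)] : List (ℕ × ℕ)).map fun qe => qe.1 ^ qe.2).prod = (-2176409088000 : ℤ).natAbs :=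
  ⟨by decide +kernel, by decide +kernel⟩

/-- **U₁ AT `171360ca1` BY THE INERT-CARRIER (Shimura-curve) ROAD, TU|inert** — `MissingUpperBoundAt W 3` at `W = E` from rhp-p2 g10's instrument
p657297 (two carriers, Papikian–Rabinoff (DEG)) through the §0 door `leafRankOneUpper_three_of_twoCarriers_of_sqrtField` of part one.  PRINTED: `hGZK hmod hnf hJL hCO hHK`.  KERNEL: `Addv ∧ SubGss` at `3`;
`7`, `5` split (nodal roots `2`, `1`); every prime of `Δ_min` enumerated (`krausList_171360ca1`) for `hothers` and `hshape` (`c = 1` off `Δ_min`, Kodaira–Néron at the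
multiplicative primes, Tate certificates at the additive primes `[2, 3]`); the congruences making `7`, `5` inert and the other `ℓ ∣ N` split in `ℚ(√-263)`; the twist
identity `Cd • E^{(-263)} = Wd`, `Cd = [1, 0, 0, 0]`, with `Wd` Kraus-minimal.  DISPLAYED: `hN`, `hr`, `Dt`/`hc` (`3 ∤ c(Dt)`), `hLt` (`L(E^{(-263)},1) ≠ 0`), `hqd`/`hvd`
(`#Ш(Wd)_an = 1`).  NO ¬CM / S2 / Σ / L₀.  Per curve; U₁ (26022) stays OPEN class-wide; `BSDp W 3` follows by `bsdp_three_of_upper_of_shaAn_unit`; BSD is NOT proved by this.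
[cite: JetchevSkinnerWan2017, §7.4.2 (p. 31)] [cite: PastenShimura2024, Prop. 6.13, Lemma 6.18] [cite: SilvermanAEC2009, VII.5 Prop. 5.1] [cite: Cremona2006, Table 1 (Cremona label 171360ca1)] -/
theorem u1_at_171360ca1
    (hGZK : rank_eq_analyticRank_of_analyticRank_le_one) (hmod : hasEntireLFunction_rat)
    (hnf : exists_isNewformOf) (hJL : nonempty_shimuraParametrizationData)
    (hCO : PastenShimura2024_componentOrders)
    (hHK : shimuraCurve_heegnerPoint_grossZagier_kolyvagin)
    {W : WeierstrassCurve ℚ} [W.IsElliptic] [W.IsGloballyMinimal] (hWeq : W = (⟨0, 0, 0, -4392, -132624⟩ : WeierstrassCurve ℚ))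
    (hN : W.conductorNorm ℤ = 171360) [NeZero (W.conductorNorm ℤ)] (hr : W.analyticRank = 1)
    (Dt : ModularParametrizationData W (W.conductorNorm ℤ)) (hc : ¬ (3 : ℤ) ∣ Dt.c)
    (hLt : (W.quadraticTwist (((-263 : ℤ) : ℚ))).entireLFunction 1 ≠ 0)
    {qd : ℚ} (hqd : haveI := isElliptic_sWd171360ca1; shaAn (⟨0, 0, 0, -303790248, 2412622466928⟩ : WeierstrassCurve ℚ) = (qd : ℂ))
    (hvd : padicValRat 3 qd ≤ 0) :
    MissingUpperBoundAt W 3 := by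
  subst hWeq
  haveI := isElliptic_sWd171360ca1; haveI := isGloballyMinimal_sWd171360ca1
  have hI : integralModelInt (⟨0, 0, 0, -4392, -132624⟩ : WeierstrassCurve ℚ) = (⟨0, 0, 0, -4392, -132624⟩ : WeierstrassCurve ℤ) :=
    integralModelInt_eq_of_map_eq _ (map_mk_int 0 0 0 (-4392) (-132624))
  have hGS := subGss_three_171360ca1 (W := (⟨0, 0, 0, -4392, -132624⟩ : WeierstrassCurve ℚ)) rfl
  have hs₁ : haveI : Fact (Nat.Prime 7) := ⟨by norm_num⟩; (⟨0, 0, 0, -4392, -132624⟩ : WeierstrassCurve ℚ).HasSplitMultiplicativeReductionAtPrime 7 := by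
    refine IntModel.hasSplitMultiplicativeReductionAtPrime_of_intModel_of_root hI 7 (by rw [Δ_eq_171360ca1]; norm_num) (by rw [c₄_eq_171360ca1]; norm_num) ⟨2, ?_⟩
    simp only [WeierstrassCurve.c₄, WeierstrassCurve.b₂, WeierstrassCurve.b₄, WeierstrassCurve.b₆]; push_cast; decide
  have hs₂ : haveI : Fact (Nat.Prime 5) := ⟨by norm_num⟩; (⟨0, 0, 0, -4392, -132624⟩ : WeierstrassCurve ℚ).HasSplitMultiplicativeReductionAtPrime 5 := by
    refine IntModel.hasSplitMultiplicativeReductionAtPrime_of_intModel_of_root hI 5 (by rw [Δ_eq_171360ca1]; norm_num) (by rw [c₄_eq_171360ca1]; norm_num) ⟨1, ?_⟩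
    simp only [WeierstrassCurve.c₄, WeierstrassCurve.b₂, WeierstrassCurve.b₄, WeierstrassCurve.b₆]; push_cast; decide
  haveI : Fact ((-263 : ℤ) < 0) := ⟨by norm_num⟩; haveI : Fact (Nat.Prime 7) := ⟨by norm_num⟩; haveI : Fact (Nat.Prime 5) := ⟨by norm_num⟩
  have hothers : ∀ (ℓ : ℕ) [Fact ℓ.Prime], ℓ ≠ 7 → ℓ ≠ 5 → (⟨0, 0, 0, -4392, -132624⟩ : WeierstrassCurve ℚ).HasSplitMultiplicativeReductionAtPrime ℓ →
      ¬ 3 ∣ padicValInt ℓ (⟨0, 0, 0, -4392, -132624⟩ : WeierstrassCurve ℚ).minimalDiscriminantInt := by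
    intro ℓ hℓF hne₁ hne₂ hs
    have hd := dvd_minimalDiscriminantInt_of_mult _ ℓ hs.hasMultiplicativeReductionAtPrime
    rw [IntModel.minimalDiscriminantInt_eq hI, Δ_eq_171360ca1] at hd
    have hmem := mem_of_prime_dvd_of_prodPow_eq _ krausList_171360ca1 hℓF.out hd
    simp only [List.map_cons, List.map_nil, List.mem_cons, List.not_mem_nil, or_false] at hmem
    rcases hmem with rfl | rfl | rfl | rfl | rfl
    · exact absurd hs.hasMultiplicativeReductionAtPrime (X9.PrintCert.not_hasMultiplicativeReductionAtPrime_of_dvd_of_dvd hI 2 (by rw [Δ_eq_171360ca1]; norm_num) (by rw [c₄_eq_171360ca1]; norm_num))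
    · exact absurd hs.hasMultiplicativeReductionAtPrime (X9.PrintCert.not_hasMultiplicativeReductionAtPrime_of_dvd_of_dvd hI 3 (by rw [Δ_eq_171360ca1]; norm_num) (by rw [c₄_eq_171360ca1]; norm_num))
    · exact absurd rfl hne₂
    · exact absurd rfl hne₁
    · rw [IntModel.minimalDiscriminantInt_eq hI, Δ_eq_171360ca1, IntModel.padicValInt_eq_of_dvd_of_not_dvd 17 (e := 1) (by norm_num) (by norm_num)]
      decide
  have hshape : ∀ (q : ℕ) [Fact q.Prime], 3 ∣ ((⟨0, 0, 0, -4392, -132624⟩ : WeierstrassCurve ℚ).baseChange ℚ_[q]).localTamagawaNumber ℤ_[q] →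
      (⟨0, 0, 0, -4392, -132624⟩ : WeierstrassCurve ℚ).HasSplitMultiplicativeReductionAtPrime q := by
    intro q hqF h3
    by_cases hd : (q : ℤ) ∣ minimalDiscriminantInt (⟨0, 0, 0, -4392, -132624⟩ : WeierstrassCurve ℚ)
    swap
    · exact absurd h3 (not_three_dvd_localTamagawaNumber_of_not_dvd _ q hd)
    rw [IntModel.minimalDiscriminantInt_eq hI, Δ_eq_171360ca1] at hd
    have hmem := mem_of_prime_dvd_of_prodPow_eq _ krausList_171360ca1 hqF.out hd
    simp only [List.map_cons, List.map_nil, List.mem_cons, List.not_mem_nil, or_false] at hmem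
    rcases hmem with rfl | rfl | rfl | rfl | rfl
    · have hc2 : ((⟨0, 0, 0, -4392, -132624⟩ : WeierstrassCurve ℚ).baseChange ℚ_[2]).localTamagawaNumber ℤ_[2] = 2 := -- additive `2` (III*): Tate certificate
        IntModelTam.localTamagawaNumber_padic_eq_of_intModel_of_tamLocal hI 2 (E := ⟨2, 1, 5, 0, 0, 0, 4, 12, 9, 0, 2⟩) rfl (by decide +kernel) (c := 2) rfl
      rw [hc2] at h3; exact absurd h3 (by decide)
    · have hc3 : ((⟨0, 0, 0, -4392, -132624⟩ : WeierstrassCurve ℚ).baseChange ℚ_[3]).localTamagawaNumber ℤ_[3] = 2 := -- additive `3` (I0*): Tate certificate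
        (IntModelTam.localTamagawaNumber_padic_eq_of_intModel_of_tamZ hI 3 (F := ⟨3, 9, 0, 0, 0, 6, 0, 1⟩) rfl (by decide +kernel)).trans (by decide)
      rw [hc3] at h3; exact absurd h3 (by decide)
    · exact hs₂
    · exact hs₁
    · exact (Koly.split_and_three_dvd_of_mult_of_three_dvd_localTamagawaNumber _ 17 (IntModel.hasMultiplicativeReductionAtPrime_of_intModel hI 17 (by rw [Δ_eq_171360ca1]; norm_num) (by rw [c₄_eq_171360ca1]; norm_num)) h3).1
  have hjac : ∀ ℓ : ℕ, ℓ.Prime → ℓ ∣ (⟨0, 0, 0, -4392, -132624⟩ : WeierstrassCurve ℚ).conductorNorm ℤ → ℓ ≠ 7 → ℓ ≠ 5 → ℓ ≠ 2 →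
      jacobiSym (-263) ℓ = 1 := by
    intro ℓ hℓ hℓN hne₁ hne₂ hℓ2
    rw [hN] at hℓN
    have hmem : ℓ ∈ Nat.primeFactors 171360 := Nat.mem_primeFactors.mpr ⟨hℓ, hℓN, by norm_num⟩
    rw [show Nat.primeFactors 171360 = {2, 3, 5, 7, 17} by decide +kernel] at hmem
    simp only [Finset.mem_insert, Finset.mem_singleton] at hmem
    rcases hmem with rfl | rfl | rfl | rfl | rfl
    · exact absurd rfl hℓ2
    · norm_num [jacobiSym.mod_left]
    · exact absurd rfl hne₂
    · exact absurd rfl hne₁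
    · norm_num [jacobiSym.mod_left]
  have hWd : (⟨1, (0 : ℚ), (0 : ℚ), (0 : ℚ)⟩ : VariableChange ℚ) • (⟨0, 0, 0, -4392, -132624⟩ : WeierstrassCurve ℚ).quadraticTwist (((-263 : ℤ) : ℚ)) =
      (⟨0, 0, 0, -303790248, 2412622466928⟩ : WeierstrassCurve ℚ) := by
    push_cast; ext <;> simp [WeierstrassCurve.variableChange_a₁, WeierstrassCurve.variableChange_a₂,
      WeierstrassCurve.variableChange_a₃, WeierstrassCurve.variableChange_a₄, WeierstrassCurve.variableChange_a₆,
      WeierstrassCurve.quadraticTwist, WeierstrassCurve.b₂, WeierstrassCurve.b₄, WeierstrassCurve.b₆] <;> norm_num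
  exact leafRankOneUpper_three_of_twoCarriers_of_sqrtField hGZK hmod hnf hJL hCO hHK _ hGS.1 hGS.2 hr rfl Dt hc
    (q₁ := 7) (q₂ := 5) (by decide) hs₁ hs₂ hothers (by decide) (by decide) hshape
    (-263) (by norm_num)
    (by rw [show (-263 : ℤ).natAbs = 263 by rfl, Nat.squarefree_iff_nodup_primeFactorsList (by norm_num)]; simp)
    (Or.inr ⟨by decide, by norm_num [jacobiSym.mod_left]⟩) (by norm_num) (by norm_num [jacobiSym.mod_left]) (by norm_num) hjac
    (fun _ _ ↦ by norm_num) hLt _ _ hWd hqd hvd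

end Summit.BirchSwinnertonDyer.BirchSwinnertonDyer.Theorems.RamifiedHeegnerPairTwistUnitInert

end
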